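import Literature.AnabelianGeometry.SemiGraphs.TemperedLevelData
import Literature.AnabelianGeometry.SemiGraphs.TemperedVerticial
import Literature.AnabelianGeometry.SemiGraphs.TemperoidsHomEqResProofs
import Literature.AnabelianGeometry.SemiGraphs.TemperoidsResProofs
import HarnessLib

/-!
# [SemiAnbd] §3: transport between two charts of the tempered fundamental group

Mochizuki, *Semi-graphs of anabelioids*, Publ. RIMS **42** (2006), §3, p. 38 ("`π₁^temp(𝒢)` is
independent, up to inner automorphism, of the choice of the cofinal system") with Proposition 3.2 /
Remark 3.2.1 p. 35 ("it makes sense to write `π₁^temp(X)` … well-defined, up to inner automorphism")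
[cite: MochizukiSemiAnbd2006, Prop 3.6(ii) p.38].  In the tree a *chart* is any tempered group `Π` with
`B^temp(𝒢) ≌ B^temp(Π)` (`TemperedPiChart`, seat abc-iut-L3-t2); the theorems of §3 are typed "for every
chart", while rung 1 of the cell's ladder (seat abc-iut-L3-t9) constructs ONE chart.  This file supplies
the transport (cell row «CHART TRANSPORT», ruling 22:56:51Z (α)):

* `TemperedPiChart.exists_compatIso` — any two charts `c`, `c'` are related by mutually inverse
  continuous homomorphisms `φ : c.G → c'.G`, `ψ : c'.G → c.G` compatible with the chart equivalences
  (`c'.equiv⁻¹ ⋙ c.equiv ≅ B^temp(φ)`, and symmetrically): Proposition 3.2 (`TemperoidHomEqRes_holds`,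
  seat abc-iut-L3-d2) applied to the composite equivalence `B^temp(c'.G) ≌ B^temp(𝒢) ≌ B^temp(c.G)`,
  invertibility from `BTemp.exists_conj_of_natTrans` (the injectivity half of Proposition 3.2);
* `isVerticialHom_comp_of_compat`, `isEdgeHom_comp_of_compat`, `mem_verticialSubgroups_map`,
  `mem_edgeLikeSubgroups_map` (+ `iff` forms) — verticial / edge homomorphisms and subgroups
  (Theorem 3.7 (i), (iii) vocabulary) correspond under such `φ`;
* `VerticialLevelData.transport`, `FiniteLevelData.transport` — level data of one chart yield level
  data of any other (same tower, actions precomposed with `ψ`, identifications moved along `φ`);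
  `FiniteLevelData.nonempty_of_nonempty` — so the producer of rung 1 may deliver the data for its
  own chart only.
Nothing here takes a side on [IUTchIII] Cor. 3.12.
-/

namespace Literature.AnabelianGeometry.SemiGraphs

open CategoryTheory CategoryTheory.Limits Topology

universe v u

/-! ### `B^temp` of the identity -/

namespace BTemp

variable {G : Type u} [Group G] [TopologicalSpace G]

/-- The natural transformation `𝟭 ⟶ B^temp(id)` (componentwise the identity map). [folklore] -/
private def toResId : 𝟭 (BTemp G) ⟶ BTemp.res (ContinuousMonoidHom.id G) where
  app X := BTemp.homOfEquivariant X ((BTemp.res (ContinuousMonoidHom.id G)).obj X) id fun _ _ => rfl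
  naturality X Y f := by
    apply ObjectProperty.hom_ext
    apply Action.Hom.ext
    exact ConcreteCategory.hom_ext _ _ fun _ => rfl

/-- Conjugation by `g` as a continuous homomorphism. [folklore] -/
private def conjHom [IsTopologicalGroup G] (g : G) : G →ₜ* G where
  toMonoidHom := (MulAut.conj g).toMonoidHom
  continuous_toFun := by
    change Continuous fun x => g * x * g⁻¹
    fun_prop

/-- `conjHom g x = g x g⁻¹`. [folklore] -/
@[simp] private theorem conjHom_apply [IsTopologicalGroup G] (g x : G) :
    conjHom g x = g * x * g⁻¹ := rfl

end BTemp

namespace ProfiniteSemiGraph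

variable {𝒢 : ProfiniteSemiGraph.{u}}

/-! ### Any two charts are compatibly isomorphic -/

namespace TemperedPiChart

/-- One half of the comparison: a continuous `φ : c.G → c'.G` whose pull-back functor is the
composite equivalence `B^temp(c'.G) ≌ B^temp(𝒢) ≌ B^temp(c.G)` (Proposition 3.2, surjectivity
half). [cite: MochizukiSemiAnbd2006, Prop 3.2 p.35] -/
theorem exists_hom_compat (c c' : TemperedPiChart 𝒢) :
    ∃ φ : c.G →ₜ* c'.G, Nonempty (c'.equiv.inverse ⋙ c.equiv.functor ≅ BTemp.res φ) := by
  haveI := c.secondCountableTopology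
  haveI := c'.secondCountableTopology
  haveI : PreservesFiniteLimits (c'.equiv.inverse ⋙ c.equiv.functor) := ⟨fun J _ _ => inferInstance⟩
  let Φ : TemperoidHom (BTemp c.G) (BTemp c'.G) :=
    ⟨c'.equiv.inverse ⋙ c.equiv.functor, inferInstance, fun J _ _ => inferInstance⟩
  obtain ⟨φ, hφ⟩ := TemperoidHomEqRes_holds c.G c'.G c.isTempered c'.isTempered Φ
  exact ⟨φ, hφ⟩

/-- **Charts are compatibly isomorphic** ("`π₁^temp(𝒢)` is independent, up to inner automorphism, of
the choice", p. 38; Rmk. 3.2.1): for two charts `c`, `c'` there are mutually inverse continuous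
homomorphisms `φ : c.G → c'.G`, `ψ : c'.G → c.G` such that `B^temp(φ)` (resp. `B^temp(ψ)`) is the
composite of the chart equivalences. [cite: MochizukiSemiAnbd2006, Prop 3.6(ii) p.38] -/
theorem exists_compatIso (c c' : TemperedPiChart 𝒢) :
    ∃ (φ : c.G →ₜ* c'.G) (ψ : c'.G →ₜ* c.G), (∀ x, ψ (φ x) = x) ∧ (∀ y, φ (ψ y) = y) ∧
      Nonempty (c'.equiv.inverse ⋙ c.equiv.functor ≅ BTemp.res φ) ∧
      Nonempty (c.equiv.inverse ⋙ c'.equiv.functor ≅ BTemp.res ψ) := by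
  obtain ⟨φ, ⟨iφ⟩⟩ := exists_hom_compat c c'
  obtain ⟨ψ₀, ⟨iψ⟩⟩ := exists_hom_compat c' c
  -- `B^temp(ψ₀ then φ) ≅ 𝟭`, hence `φ ∘ ψ₀` is inner
  have h1 : ∃ g : c'.G, ∀ a : c'.G, g * φ (ψ₀ a) * g⁻¹ = a := by
    let i1 : BTemp.res (φ.comp ψ₀) ≅ 𝟭 (BTemp c'.G) :=
      (Functor.isoWhiskerRight iφ.symm (BTemp.res ψ₀) ≪≫
        Functor.isoWhiskerLeft (c'.equiv.inverse ⋙ c.equiv.functor) iψ.symm :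
          BTemp.res φ ⋙ BTemp.res ψ₀ ≅
            (c'.equiv.inverse ⋙ c.equiv.functor) ⋙ (c.equiv.inverse ⋙ c'.equiv.functor)) ≪≫
      (Functor.isoWhiskerLeft c'.equiv.inverse
          (Functor.isoWhiskerRight c.equiv.unitIso.symm c'.equiv.functor ≪≫
            c'.equiv.functor.leftUnitor) :
          c'.equiv.inverse ⋙ (c.equiv.functor ⋙ c.equiv.inverse) ⋙ c'.equiv.functor ≅
            c'.equiv.inverse ⋙ c'.equiv.functor) ≪≫
      c'.equiv.counitIso
    obtain ⟨g, hg, -⟩ := BTemp.exists_conj_of_natTrans c'.isTempered (φ.comp ψ₀)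
      (ContinuousMonoidHom.id c'.G) (i1.hom ≫ BTemp.toResId)
    exact ⟨g, fun a => by simpa using hg a⟩
  have h2 : ∃ g : c.G, ∀ b : c.G, g * ψ₀ (φ b) * g⁻¹ = b := by
    let i2 : BTemp.res (ψ₀.comp φ) ≅ 𝟭 (BTemp c.G) :=
      (Functor.isoWhiskerRight iψ.symm (BTemp.res φ) ≪≫
        Functor.isoWhiskerLeft (c.equiv.inverse ⋙ c'.equiv.functor) iφ.symm :
          BTemp.res ψ₀ ⋙ BTemp.res φ ≅
            (c.equiv.inverse ⋙ c'.equiv.functor) ⋙ (c'.equiv.inverse ⋙ c.equiv.functor)) ≪≫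
      (Functor.isoWhiskerLeft c.equiv.inverse
          (Functor.isoWhiskerRight c'.equiv.unitIso.symm c.equiv.functor ≪≫
            c.equiv.functor.leftUnitor) :
          c.equiv.inverse ⋙ (c'.equiv.functor ⋙ c'.equiv.inverse) ⋙ c.equiv.functor ≅
            c.equiv.inverse ⋙ c.equiv.functor) ≪≫
      c.equiv.counitIso
    obtain ⟨g, hg, -⟩ := BTemp.exists_conj_of_natTrans c.isTempered (ψ₀.comp φ)
      (ContinuousMonoidHom.id c.G) (i2.hom ≫ BTemp.toResId)
    exact ⟨g, fun b => by simpa using hg b⟩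
  obtain ⟨g, hg⟩ := h1
  obtain ⟨g', hg'⟩ := h2
  haveI := c'.isTopologicalGroup
  -- the corrected inverse `ψ := ψ₀ ∘ conj(g)`
  let ψ : c'.G →ₜ* c.G := ψ₀.comp (BTemp.conjHom g)
  have hφψ : ∀ y, φ (ψ y) = y := by
    intro y
    have e1 := hg (g * y * g⁻¹)
    -- `g * φ(ψ₀(g y g⁻¹)) * g⁻¹ = g y g⁻¹` ⇒ `φ(ψ₀(g y g⁻¹)) = y`
    have e2 : φ (ψ₀ (g * y * g⁻¹)) = y := by
      have := congrArg (fun z => g⁻¹ * z * g) e1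
      simpa [mul_assoc] using this
    simpa [ψ] using e2
  have hinj : Function.Injective φ := by
    intro b₁ b₂ h
    have := congrArg (fun z => g' * ψ₀ z * g'⁻¹) h
    simpa [hg'] using this
  have hψφ : ∀ x, ψ (φ x) = x := fun x => hinj (hφψ (φ x))
  refine ⟨φ, ψ, hψφ, hφψ, ⟨iφ⟩, ⟨iψ ≪≫ BTemp.resIsoOfConj ψ₀ ψ (ψ₀ g) fun a => ?_⟩⟩
  change ψ₀ g * ψ₀ a * (ψ₀ g)⁻¹ = ψ₀ (g * a * g⁻¹)
  rw [map_mul, map_mul, map_inv]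

end TemperedPiChart

/-! ### Transport of verticial and edge homomorphisms / subgroups -/

section Transport

variable {c c' : TemperedPiChart 𝒢} (φ : c.G →ₜ* c'.G)
  (hφ : Nonempty (c'.equiv.inverse ⋙ c.equiv.functor ≅ BTemp.res φ))

include hφ in
/-- `c'.equiv⁻¹ ≅ B^temp(φ) ⋙ c.equiv⁻¹` for a compatible `φ`. [cite: MochizukiSemiAnbd2006, Prop 3.6(ii) p.38] -/
theorem nonempty_inverse_iso : Nonempty (c'.equiv.inverse ≅ BTemp.res φ ⋙ c.equiv.inverse) := by
  obtain ⟨i⟩ := hφ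
  exact ⟨(c'.equiv.inverse.rightUnitor.symm ≪≫
      Functor.isoWhiskerLeft c'.equiv.inverse c.equiv.unitIso :
        c'.equiv.inverse ≅ (c'.equiv.inverse ⋙ c.equiv.functor) ⋙ c.equiv.inverse) ≪≫
    Functor.isoWhiskerRight i c.equiv.inverse⟩

include hφ in
/-- Verticial homomorphisms transport: if `χ : Π_v → c.G` is verticial for `c`, then `φ ∘ χ` is
verticial for `c'`. [cite: MochizukiSemiAnbd2006, Thm 3.7(i) p.40] -/
theorem isVerticialHom_comp_of_compat {v : 𝒢.graph.Vertex} {χ : 𝒢.Gv v →ₜ* c.G}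
    (hχ : IsVerticialHom c v χ) : IsVerticialHom c' v (φ.comp χ) := by
  obtain ⟨k⟩ := nonempty_inverse_iso φ hφ
  obtain ⟨j⟩ := hχ
  exact ⟨(Functor.isoWhiskerRight k (ObjectProperty.ι _ ⋙ restrictV 𝒢 v) :
      c'.equiv.inverse ⋙ ObjectProperty.ι _ ⋙ restrictV 𝒢 v ≅
        BTemp.res φ ⋙ (c.equiv.inverse ⋙ ObjectProperty.ι _ ⋙ restrictV 𝒢 v)) ≪≫
    Functor.isoWhiskerLeft (BTemp.res φ) j⟩

include hφ in
/-- Edge homomorphisms transport likewise. [cite: MochizukiSemiAnbd2006, Thm 3.7(iii) p.41] -/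
theorem isEdgeHom_comp_of_compat {e : 𝒢.graph.Edge} {χ : 𝒢.Ge e →ₜ* c.G}
    (hχ : IsEdgeHom c e χ) : IsEdgeHom c' e (φ.comp χ) := by
  obtain ⟨k⟩ := nonempty_inverse_iso φ hφ
  obtain ⟨j⟩ := hχ
  exact ⟨(Functor.isoWhiskerRight k (ObjectProperty.ι _ ⋙ restrictE 𝒢 e) :
      c'.equiv.inverse ⋙ ObjectProperty.ι _ ⋙ restrictE 𝒢 e ≅
        BTemp.res φ ⋙ (c.equiv.inverse ⋙ ObjectProperty.ι _ ⋙ restrictE 𝒢 e)) ≪≫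
    Functor.isoWhiskerLeft (BTemp.res φ) j⟩

include hφ in
/-- Verticial subgroups transport: `φ(H)` is verticial for `c'` if `H` is for `c`.
[cite: MochizukiSemiAnbd2006, Thm 3.7(i) p.40] -/
theorem mem_verticialSubgroups_map {v : 𝒢.graph.Vertex} {H : Subgroup c.G}
    (hH : H ∈ verticialSubgroups c v) : H.map φ.toMonoidHom ∈ verticialSubgroups c' v := by
  obtain ⟨χ, hχ, rfl⟩ := hH
  exact ⟨φ.comp χ, isVerticialHom_comp_of_compat φ hφ hχ, by rw [MonoidHom.map_range]; rfl⟩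

include hφ in
/-- Edge-like subgroups transport. [cite: MochizukiSemiAnbd2006, Thm 3.7(iii) p.41] -/
theorem mem_edgeLikeSubgroups_map {e : 𝒢.graph.Edge} {L : Subgroup c.G}
    (hL : L ∈ edgeLikeSubgroups c e) : L.map φ.toMonoidHom ∈ edgeLikeSubgroups c' e := by
  obtain ⟨χ, hχ, rfl⟩ := hL
  exact ⟨φ.comp χ, isEdgeHom_comp_of_compat φ hφ hχ, by rw [MonoidHom.map_range]; rfl⟩

variable (ψ : c'.G →ₜ* c.G) (hφψ : ∀ y, φ (ψ y) = y)
  (hψ : Nonempty (c.equiv.inverse ⋙ c'.equiv.functor ≅ BTemp.res ψ))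

/-- `f(g(H)) = H` for `f ∘ g = id`. [folklore] -/
private theorem map_map_eq_of_leftInverse {A B : Type u} [Group A] [Group B] (f : A →* B) (g : B →* A)
    (h : ∀ x, f (g x) = x) (H : Subgroup B) : (H.map g).map f = H := by
  ext y
  constructor
  · rintro ⟨_, ⟨z, hz, rfl⟩, rfl⟩
    rw [h]; exact hz
  · intro hy
    exact ⟨g y, ⟨y, hy, rfl⟩, h y⟩

include hφ hψ hφψ in
/-- Verticial subgroups of `c'` are exactly those whose image under `ψ` is verticial for `c`.
[cite: MochizukiSemiAnbd2006, Thm 3.7(i) p.40] -/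
theorem mem_verticialSubgroups_iff_map {v : 𝒢.graph.Vertex} (H : Subgroup c'.G) :
    H ∈ verticialSubgroups c' v ↔ H.map ψ.toMonoidHom ∈ verticialSubgroups c v := by
  refine ⟨fun hH => mem_verticialSubgroups_map ψ hψ hH, fun hH => ?_⟩
  have h := mem_verticialSubgroups_map φ hφ hH
  rwa [map_map_eq_of_leftInverse φ.toMonoidHom ψ.toMonoidHom hφψ H] at h

include hφ hψ hφψ in
/-- Edge-like subgroups of `c'` are exactly those whose image under `ψ` is edge-like for `c`.
[cite: MochizukiSemiAnbd2006, Thm 3.7(iii) p.41] -/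
theorem mem_edgeLikeSubgroups_iff_map {e : 𝒢.graph.Edge} (L : Subgroup c'.G) :
    L ∈ edgeLikeSubgroups c' e ↔ L.map ψ.toMonoidHom ∈ edgeLikeSubgroups c e := by
  refine ⟨fun hL => mem_edgeLikeSubgroups_map ψ hψ hL, fun hL => ?_⟩
  have h := mem_edgeLikeSubgroups_map φ hφ hL
  rwa [map_map_eq_of_leftInverse φ.toMonoidHom ψ.toMonoidHom hφψ L] at h

end Transport

/-! ### Transport of level data -/

namespace VerticialLevelData

variable {c c' : TemperedPiChart 𝒢}

/-- **Level data transport along a compatible isomorphism of charts**: the same tower of trees, the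
actions precomposed with `ψ : c'.G → c.G`, the identifications (I1)–(I3) moved along `φ = ψ⁻¹`.
[cite: MochizukiSemiAnbd2006, Thm 3.7(iii) p.41] -/
def transport (D : VerticialLevelData.{v} 𝒢 c) (φ : c.G →ₜ* c'.G) (ψ : c'.G →ₜ* c.G)
    (hψφ : ∀ x, ψ (φ x) = x) (hφψ : ∀ y, φ (ψ y) = y)
    (hV : ∀ (v : 𝒢.graph.Vertex) (H : Subgroup c'.G),
      H ∈ verticialSubgroups c' v ↔ H.map ψ.toMonoidHom ∈ verticialSubgroups c v)
    (hE : ∀ (e : 𝒢.graph.Edge) (L : Subgroup c'.G),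
      L ∈ edgeLikeSubgroups c' e ↔ L.map ψ.toMonoidHom ∈ edgeLikeSubgroups c e) :
    VerticialLevelData.{v} 𝒢 c' where
  J := D.J
  tree := D.tree
  isTree := D.isTree
  vertex := D.vertex
  proj := D.proj
  act j := (D.act j).comp ψ.toMonoidHom
  isOpen_ker j := by
    rw [← MonoidHom.comap_ker]
    exact (D.isOpen_ker j).preimage ψ.continuous
  act_over j g := D.act_over j (ψ g)
  trans := D.trans
  trans_id := D.trans_id
  trans_comp := D.trans_comp
  trans_over := D.trans_over
  trans_act _ _ h g := D.trans_act h (ψ g)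
  fix v H hH := by
    obtain ⟨x, hxc, hxf⟩ := D.fix v (H.map ψ.toMonoidHom) ((hV v H).1 hH)
    exact ⟨x, hxc, fun g hg j => hxf (ψ g) ⟨g, hg, rfl⟩ j⟩
  stab x hx := by
    obtain ⟨v, H, hH, hst⟩ := D.stab x hx
    refine ⟨v, H.map φ.toMonoidHom, (hV v _).2 ?_, fun g hg => ⟨ψ g, hst (ψ g) hg, hφψ g⟩⟩
    rwa [map_map_eq_of_leftInverse ψ.toMonoidHom φ.toMonoidHom hψφ H]
  edge j₁ ε hε := by
    obtain ⟨e, L, hL, hpe, hLst⟩ := D.edge j₁ ε hε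
    refine ⟨e, L.map φ.toMonoidHom, (hE e _).2 ?_, hpe, fun g hg => ⟨ψ g, hLst (ψ g) hg, hφψ g⟩⟩
    rwa [map_map_eq_of_leftInverse ψ.toMonoidHom φ.toMonoidHom hψφ L]

end VerticialLevelData

namespace FiniteLevelData

variable {c c' : TemperedPiChart 𝒢}

/-- **Finite-level data transport along a compatible isomorphism of charts**: the tree-level part by
`VerticialLevelData.transport`, the finite levels with actions precomposed with `ψ`, and (I4′) with
`ιQ` replaced by `ιQ ∘ ψ`. [cite: MochizukiSemiAnbd2006, Thm 3.7(iii) p.41] -/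
def transport (D : FiniteLevelData.{v} 𝒢 c) (φ : c.G →ₜ* c'.G) (ψ : c'.G →ₜ* c.G)
    (hψφ : ∀ x, ψ (φ x) = x) (hφψ : ∀ y, φ (ψ y) = y)
    (hV : ∀ (v : 𝒢.graph.Vertex) (H : Subgroup c'.G),
      H ∈ verticialSubgroups c' v ↔ H.map ψ.toMonoidHom ∈ verticialSubgroups c v)
    (hE : ∀ (e : 𝒢.graph.Edge) (L : Subgroup c'.G),
      L ∈ edgeLikeSubgroups c' e ↔ L.map ψ.toMonoidHom ∈ edgeLikeSubgroups c e) :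
    FiniteLevelData.{v} 𝒢 c' where
  toVerticialLevelData := D.toVerticialLevelData.transport φ ψ hψφ hφψ hV hE
  level := D.level
  finiteVertex := D.finiteVertex
  finiteBranch := D.finiteBranch
  quot := D.quot
  quot_isImmersion := D.quot_isImmersion
  levelAct j := (D.levelAct j).comp ψ.toMonoidHom
  act_quot j g := D.act_quot j (ψ g)
  levelTrans := D.levelTrans
  levelTrans_id := D.levelTrans_id
  levelTrans_comp := D.levelTrans_comp
  levelTrans_act _ _ h g := D.levelTrans_act h (ψ g)
  trans_quot := D.trans_quot
  stabBranchPair' j₀ w β β' hpair hcompat := by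
    obtain ⟨Q, _, ιQ, v, b, b', hb, hb', ψQ, x, x', hι, hψQ, hne, hst⟩ :=
      D.stabBranchPair' j₀ w β β' hpair hcompat
    have hψinj : Function.Injective ψ := fun y₁ y₂ h => by rw [← hφψ y₁, ← hφψ y₂, h]
    exact ⟨Q, inferInstance, ιQ.comp ψ.toMonoidHom, v, b, b', hb, hb', ψQ, x, x', hι.comp hψinj, hψQ,
      hne, fun g hg => hst (ψ g) hg⟩

/-- **Finite-level data for ONE chart give finite-level data for EVERY chart** (charts are compatibly
isomorphic, `TemperedPiChart.exists_compatIso`, and the §3 vocabulary transports): the producer of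
rung 1 may deliver the data for its own constructed chart. [cite: MochizukiSemiAnbd2006, Prop 3.6(ii) p.38] -/
theorem nonempty_of_nonempty {c₀ : TemperedPiChart 𝒢} (h : Nonempty (FiniteLevelData.{v} 𝒢 c₀))
    (c : TemperedPiChart 𝒢) : Nonempty (FiniteLevelData.{v} 𝒢 c) := by
  obtain ⟨D⟩ := h
  obtain ⟨φ, ψ, hψφ, hφψ, hφ, hψ⟩ := TemperedPiChart.exists_compatIso c₀ c
  exact ⟨D.transport φ ψ hψφ hφψ (fun v H => mem_verticialSubgroups_iff_map φ hφ ψ hφψ hψ H)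
    (fun e L => mem_edgeLikeSubgroups_iff_map φ hφ ψ hφψ hψ L)⟩

end FiniteLevelData

end ProfiniteSemiGraph

end Literature.AnabelianGeometry.SemiGraphs
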